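import Summits.Langlands.Langlands.Theses.RefinementCarving

/-!
# Route RefinementCarving — Assembly

The assembly item (stmt-Langlands-27214) of the child route `RefinementCarving` (decomp-langlands lens-6 gen 21; a gate-native D-0170
refining child: `--refines route-Langlands-PadicReachabilityCarving:ReachableIrregularCoreAtP`, edge split, depth 1, no FRAME item) for the crux
RI = `PadicReachabilityCarving.ReachableIrregularCoreAtP` (stmt-Langlands-26900):
`RefinedIrregularCoreAtP → UnrefinedIrregularCoreAtP → PadicReachabilityCarving.ReachableIrregularCoreAtP`.

This is literally the type of the route file's sorry-free deciding theorem `Summit.Langlands.Langlands.Theses.RefinementCarving.closes`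
(one excluded middle on the dial «π_v is a regular principal series at v ∣ ℓ»).  Nothing here proves `Langlands` (nor RI): the assembly records
only that the two ledger items of the route, taken together, imply the refined crux.
-/

set_option linter.dupNamespace false -- project-wide option (lakefile weak.linter.dupNamespace); `Summit.Langlands.Langlands` is the mandated namespace

namespace Summit.Langlands.Langlands.Theorems

/-- **Assembly of route RefinementCarving** (stmt-Langlands-27214): `REF → UNREF → PadicReachabilityCarving.ReachableIrregularCoreAtP`.
Proof: unfold `Assembly` and apply the route's deciding theorem `Theses.RefinementCarving.closes`. -/
theorem refinementCarving_assembly_proof :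
    Summit.Langlands.Langlands.Theses.RefinementCarving.Assembly := by
  unfold Summit.Langlands.Langlands.Theses.RefinementCarving.Assembly
  exact Summit.Langlands.Langlands.Theses.RefinementCarving.closes

end Summit.Langlands.Langlands.Theorems
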